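import Mathlib
import Literature.Combinatorics.Optimization.PseudoDensityFourier
import Literature.Computability.Complexity.FourierDegreeAlgebra
import Literature.Computability.MetaComplexity.XorPseudoexpectation

/-!
# The Grigoriev–Schoenebeck pseudo-moments as a pseudo-density on the cube

Bridge between the tree's two sum-of-squares vocabularies, for the purpose of discharging the two
Grigoriev/Schoenebeck-named facts of the psd-rank / LP-size layer
(`Schoenebeck2008_maxThreeSatSos` in `SDPRelaxationsMaxCSP.lean` = Lee–Raghavendra–Steurer 2015
Thm 6.5, and `Schoenebeck2008_maxThreeXorSA` in `MaxThreeXorLpLowerBound.lean` = Kothari–Meka–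
Raghavendra 2017 Thm 7.5):

* `Literature/Computability/MetaComplexity/XorDerivation.lean` + `XorPseudoexpectation.lean` PROVE
  the deterministic Grigoriev–Schoenebeck theorem in the MOMENT language: for a family of parity
  constraints `y_{g i} = b i` (`g i` parity vectors, `b i = ±1`) whose scope vectors are
  `(r, c)`-vector expanding, the pseudo-moments `Ẽ[y_T] = pseudoMoment g b r d T` (`T` a parity
  vector, `d ≤ c r / 2`) are normalised (`pseudoMoment_zero`), positive semidefinite on half-degree
  monomials (`pseudoMoment_quadratic_nonneg`), shift by a constraint (`pseudoMoment_index_add`) and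
  pair to zero against the Fourier expansion of a clause (`sum_posSign_pseudoMoment_eq_zero`);
* `Literature/Combinatorics/Optimization/PatternMatrixPsdRank.lean` (Lee–Raghavendra–Steurer) has
  the CUBE language: `cubeExpect`, `HasDegreeLE`, degree-`d` pseudo-DENSITIES `IsPseudoDensity d D`
  (`E D = 1`, `E D g² ≥ 0` for `deg g ≤ d/2`) and sum-of-squares certificates `HasSosCertificate`,
  with the weak duality `IsPseudoDensity.cubeExpect_mul_nonneg`.

Following Fleming–Kothari–Pitassi 2019, §5.1 (proof of Lemma 5.6, "our pseudo-expectation …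
if the monomial is determined, then we set its pseudo-expectation to this value, and otherwise … to
`0`", p. 150 of the held text) we define the **Grigoriev–Schoenebeck pseudo-density** on
`{0,1}ⁿ` as the Walsh series of the pseudo-moments,
`gsDensity n g b r d (x) = Σ_{U ⊆ [n]} Ẽ[y_U] χ_U(x)`, and PROVE:

* `cubeFourierCoeff_gsDensity`, `cubeExpect_gsDensity_mul_walsh`: `E_x D(x) χ_V(x) = Ẽ[y_V]`;
  `cubeExpect_gsDensity`: `E D = 1`;
* `cubeExpect_gsDensity_mul_sq_nonneg`: `E D q² ≥ 0` for `deg q ≤ d/2` — Plancherel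
  (`cubeExpect_mul_eq_sum_cubeFourierCoeff`), the convolution formula (`cubeFourierCoeff_mul`),
  the reindexing `U = S ∆ T` and `pseudoMoment_quadratic_nonneg`; hence
  **`isPseudoDensity_gsDensity`** (FKP19 Lemma 5.6, hard direction, in density form);
* `cubeExpect_gsDensity_mul_unsatInd`: for a clause `C` on distinct variables `< n` occurring in
  the family (`g i = clauseVec C`, `b i = clauseSign C`, `|C| ≤ d`), `E_x D(x)·[C false at x] = 0`
  (Schoenebeck 2008 §5 "from 3-XOR to 3-SAT": the Walsh expansion
  `[C false] = 2^{-|C|} Σ_J σ_J χ_{vars J}` paired with `sum_posSign_pseudoMoment_eq_zero`);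
* `cubeExpect_gsDensity_mul_xorSatInd`: for a parity constraint `χ_S = b i` of the family with
  `|S| ≤ d`, `E_x D(x)·[χ_S(x) = b i] = 1`.

Everything is proved; no named facts (D-0026: net debt 0). Consumers: the assembly file
`ThreeSatThreeXorSosGaps.lean` (same directory).

## References

* N. Fleming, P. Kothari, T. Pitassi, *Semialgebraic Proofs and Efficient Algorithm Design*,
  Found. Trends TCS 14 (2019), §5.1 (Thm 5.2, Lemmas 5.3, 5.6, 5.7, 5.9) [FlemingKothariPitassi2019];
  held text `paper:galaxy-pdf-4841134338957687840`, pp. 147–154.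
* D. Grigoriev, *Linear lower bound on degrees of Positivstellensatz calculus proofs for the
  parity*, Theoret. Comput. Sci. 259 (2001) 613–622 [Grigoriev2001TCS].
* G. Schoenebeck, *Linear level Lasserre lower bounds for certain k-CSPs*, FOCS 2008
  (doi:10.1109/FOCS.2008.74), Thm 4.1, Lemma 4.4, §5.
-/

noncomputable section

open Finset
open scoped symmDiff
open Literature.Probability.RandomGraphs.LowDegree (walsh sgn walsh_empty sgn_mul_self)
open Literature.Computability.Complexity.LowDegree (cubeFourierCoeff cubeFourierCoeff_mul
  walsh_mul_walsh sum_cubeFourierCoeff_mul_walsh)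
open Literature.Computability.Complexity (Literal Clause)
open Literature.Computability.MetaComplexity (ParityVec indVec indVec_apply support_indVec
  pseudoMoment VecExpands pseudoMoment_zero pseudoMoment_quadratic_nonneg pseudoMoment_index_add
  sum_posSign_pseudoMoment_eq_zero litSign posSign litVec clauseVec clauseSign derivable_zero
  posSign_mul_self litSign_mul_self)

namespace Literature.Combinatorics.Optimization

variable {n : ℕ}

/-! ### Subsets of `[n]` as parity vectors -/

/-- The parity vector (over all naturals) of a set of variables `U ⊆ [n]`.
[cite: FlemingKothariPitassi2019, §5.1 (Def. 5.4: monomials `x_S`)] -/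
def toVec (U : Finset (Fin n)) : ParityVec := indVec (U.map Fin.valEmbedding)

/-- Values of `toVec U`. [cite: FlemingKothariPitassi2019, §5.1 (Def. 5.4, p. 148)] -/
theorem toVec_apply (U : Finset (Fin n)) (w : ℕ) :
    toVec U w = if w ∈ U.map Fin.valEmbedding then 1 else 0 := by
  rw [toVec, indVec_apply]

/-- The support of `toVec U` is `U` (as naturals). [cite: FlemingKothariPitassi2019, §5.1 (Def. 5.4, p. 148)] -/
theorem support_toVec (U : Finset (Fin n)) : (toVec U).support = U.map Fin.valEmbedding := by
  rw [toVec, support_indVec]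

/-- `|supp (toVec U)| = |U|` (the degree of the monomial `x_U`). [cite: FlemingKothariPitassi2019, §5.1 (Def. 5.4, p. 148)] -/
theorem card_support_toVec (U : Finset (Fin n)) : (toVec U).support.card = U.card := by
  rw [support_toVec, card_map]

/-- `toVec ∅ = 0` (the empty monomial). [cite: FlemingKothariPitassi2019, §5.1 (proof of Lemma 5.6, p. 150)] -/
theorem toVec_empty : toVec (∅ : Finset (Fin n)) = 0 := by
  ext w; simp [toVec_apply]

/-- `toVec` is injective. [cite: FlemingKothariPitassi2019, §5.1 (proof of Lemma 5.6, p. 150)] -/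
theorem toVec_injective : Function.Injective (toVec (n := n)) := by
  intro S T h
  have := congrArg Finsupp.support h
  rw [support_toVec, support_toVec] at this
  exact Finset.map_injective _ this

/-- Symmetric difference goes to the sum (characteristic two): `x_S · x_{S'} = x_{S △ S'}`.
[cite: FlemingKothariPitassi2019, §5.1 (Def. 5.4, p. 148)] -/
theorem toVec_symmDiff (S T : Finset (Fin n)) : toVec (S ∆ T) = toVec S + toVec T := by
  ext w
  rw [Finsupp.add_apply, toVec_apply, toVec_apply, toVec_apply]
  by_cases hw : w < n
  · have key : ∀ U : Finset (Fin n), (w ∈ U.map Fin.valEmbedding) ↔ (⟨w, hw⟩ : Fin n) ∈ U := by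
      intro U
      constructor
      · intro h
        obtain ⟨i, hi, hiw⟩ := Finset.mem_map.1 h
        have : i = ⟨w, hw⟩ := Fin.ext (by simpa using hiw)
        rwa [this] at hi
      · intro h
        exact Finset.mem_map.2 ⟨⟨w, hw⟩, h, rfl⟩
    simp only [key, Finset.mem_symmDiff]
    by_cases hS : (⟨w, hw⟩ : Fin n) ∈ S <;> by_cases hT : (⟨w, hw⟩ : Fin n) ∈ T <;>
      simp [hS, hT, CharTwo.add_self_eq_zero]
  · have key : ∀ U : Finset (Fin n), w ∉ U.map Fin.valEmbedding := by
      intro U h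
      obtain ⟨i, -, hiw⟩ := Finset.mem_map.1 h
      exact hw (by rw [← hiw]; exact i.2)
    simp [key]

/-- Back from a parity vector supported in `[n]` to the set of variables. [folklore] -/
def ofVec (T : ParityVec) : Finset (Fin n) := univ.filter fun i => (i : ℕ) ∈ T.support

/-- `ofVec (toVec U) = U`. [cite: FlemingKothariPitassi2019, §5.1 (proof of Lemma 5.6, p. 150)] -/
theorem ofVec_toVec (U : Finset (Fin n)) : ofVec (toVec U) = U := by
  ext i
  simp only [ofVec, mem_filter, mem_univ, true_and, support_toVec, Finset.mem_map,
    Fin.valEmbedding_apply]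
  constructor
  · rintro ⟨j, hj, hji⟩
    have : j = i := Fin.ext hji
    rwa [this] at hj
  · intro h
    exact ⟨i, h, rfl⟩

/-! ### The pseudo-density -/

section Density

variable {ι : Type*} [DecidableEq ι] (n) (g : ι → ParityVec) (b : ι → ℝ) (r : ℝ) (d : ℕ)

/-- **The Grigoriev–Schoenebeck pseudo-density** on `{0,1}ⁿ`: the Walsh series of the
pseudo-moments, `D(x) = Σ_{U ⊆ [n]} Ẽ[y_U] χ_U(x)` (so that `E_x D χ_U = Ẽ[y_U]`: determined
monomials get their derived value, undetermined ones get `0`).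
[cite: FlemingKothariPitassi2019, §5.1 (proof of Lemma 5.6, p. 150)] -/
def gsDensity : (Fin n → Bool) → ℝ :=
  fun x => ∑ U : Finset (Fin n), pseudoMoment g b r d (toVec U) * walsh U x

variable {n g b r d} {c : ℝ}

omit [DecidableEq ι] in
/-- The Walsh coefficients of the pseudo-density are the pseudo-moments.
[cite: FlemingKothariPitassi2019, §5.1 (p. 150)] -/
theorem cubeFourierCoeff_gsDensity (U : Finset (Fin n)) :
    cubeFourierCoeff (gsDensity n g b r d) U = pseudoMoment g b r d (toVec U) := by
  unfold gsDensity
  rw [cubeFourierCoeff_sum_walsh]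
  simp

omit [DecidableEq ι] in
/-- `E_x D(x) χ_V(x) = Ẽ[y_V]`. [cite: FlemingKothariPitassi2019, §5.1 (p. 150)] -/
theorem cubeExpect_gsDensity_mul_walsh (V : Finset (Fin n)) :
    cubeExpect (fun x => gsDensity n g b r d x * walsh V x) = pseudoMoment g b r d (toVec V) := by
  rw [cubeExpect_mul_walsh, cubeFourierCoeff_gsDensity]

/-- **Normalisation** `E D = 1` (`Ẽ[1] = 1`). [cite: FlemingKothariPitassi2019, §5.1 (condition 3, p. 150)] -/
theorem cubeExpect_gsDensity (hexp : VecExpands g r c) (hc : 0 < c) (hd : (d : ℝ) ≤ c * r / 2)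
    (hr : 0 ≤ r) : cubeExpect (gsDensity n g b r d) = 1 := by
  have h := cubeExpect_gsDensity_mul_walsh (n := n) (g := g) (b := b) (r := r) (d := d) ∅
  simp only [walsh_empty, mul_one] at h
  rw [toVec_empty, pseudoMoment_zero hexp hc hd hr] at h
  exact h

/-! #### Linearity helpers for `cubeExpect` -/

/-- `E (D · Σ_i f_i) = Σ_i E (D f_i)` (linearity of the pseudo-expectation). [cite: FlemingKothariPitassi2019, §5.1 (proof of Lemma 5.6, p. 150)] -/
theorem cubeExpect_mul_finset_sum {κ : Type*} (s : Finset κ) (D : (Fin n → Bool) → ℝ)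
    (f : κ → (Fin n → Bool) → ℝ) :
    cubeExpect (fun x => D x * ∑ i ∈ s, f i x) = ∑ i ∈ s, cubeExpect (fun x => D x * f i x) := by
  unfold cubeExpect
  rw [← Finset.sum_div]
  congr 1
  rw [Finset.sum_comm]
  exact Finset.sum_congr rfl fun x _ => Finset.mul_sum _ _ _

/-- `E (D · (a f)) = a E (D f)` (linearity of the pseudo-expectation). [cite: FlemingKothariPitassi2019, §5.1 (proof of Lemma 5.6, p. 150)] -/
theorem cubeExpect_mul_const_mul (D f : (Fin n → Bool) → ℝ) (a : ℝ) :
    cubeExpect (fun x => D x * (a * f x)) = a * cubeExpect (fun x => D x * f x) := by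
  unfold cubeExpect
  rw [mul_div_assoc', Finset.mul_sum]
  congr 1
  exact Finset.sum_congr rfl fun x _ => by ring

/-- `E (D · (f + h)) = E (D f) + E (D h)` (linearity of the pseudo-expectation). [cite: FlemingKothariPitassi2019, §5.1 (proof of Lemma 5.6, p. 150)] -/
theorem cubeExpect_mul_add (D f h : (Fin n → Bool) → ℝ) :
    cubeExpect (fun x => D x * (f x + h x)) =
      cubeExpect (fun x => D x * f x) + cubeExpect (fun x => D x * h x) := by
  unfold cubeExpect
  rw [← add_div, ← Finset.sum_add_distrib]
  congr 1
  exact Finset.sum_congr rfl fun x _ => by ring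

/-- `E (D · (f - h)) = E (D f) - E (D h)` (linearity of the pseudo-expectation). [cite: FlemingKothariPitassi2019, §5.1 (proof of Lemma 5.6, p. 150)] -/
theorem cubeExpect_mul_sub (D f h : (Fin n → Bool) → ℝ) :
    cubeExpect (fun x => D x * (f x - h x)) =
      cubeExpect (fun x => D x * f x) - cubeExpect (fun x => D x * h x) := by
  unfold cubeExpect
  rw [← sub_div, ← Finset.sum_sub_distrib]
  congr 1
  exact Finset.sum_congr rfl fun x _ => by ring

/-- `E (D · a) = a E D` (linearity of the pseudo-expectation). [cite: FlemingKothariPitassi2019, §5.1 (proof of Lemma 5.6, p. 150)] -/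
theorem cubeExpect_mul_const (D : (Fin n → Bool) → ℝ) (a : ℝ) :
    cubeExpect (fun x => D x * a) = a * cubeExpect D := by
  unfold cubeExpect
  rw [mul_div_assoc', Finset.mul_sum]
  congr 1
  exact Finset.sum_congr rfl fun x _ => by ring

/-! #### Positive semidefiniteness -/

omit [DecidableEq ι] in
/-- The quadratic form of the pseudo-density in Walsh coordinates:
`E D q² = Σ_S Σ_T q̂(S) q̂(T) Ẽ[y_S + y_T]` (Plancherel, convolution, `U = S ∆ T`).
[cite: FlemingKothariPitassi2019, §5.1 (proof of Lemma 5.6: `M_{S,T} = Ẽ[x_S x_T]`, p. 150)] -/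
theorem cubeExpect_gsDensity_mul_sq_eq (q : (Fin n → Bool) → ℝ) :
    cubeExpect (fun x => gsDensity n g b r d x * q x ^ 2) =
      ∑ S : Finset (Fin n), ∑ T : Finset (Fin n),
        cubeFourierCoeff q S * cubeFourierCoeff q T * pseudoMoment g b r d (toVec S + toVec T) := by
  have h0 : (fun x => gsDensity n g b r d x * q x ^ 2) =
      fun x => gsDensity n g b r d x * (q x * q x) := by
    funext x; ring
  rw [h0, cubeExpect_mul_eq_sum_cubeFourierCoeff]
  simp_rw [cubeFourierCoeff_gsDensity, cubeFourierCoeff_mul, Finset.mul_sum]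
  rw [Finset.sum_comm]
  refine Finset.sum_congr rfl fun S _ => ?_
  -- reindex `U ↦ S ∆ U`
  have hinv : Function.Involutive fun U : Finset (Fin n) => S ∆ U :=
    fun U => symmDiff_symmDiff_cancel_left S U
  rw [← Equiv.sum_comp hinv.toPerm]
  refine Finset.sum_congr rfl fun T _ => ?_
  simp only [Function.Involutive.coe_toPerm]
  rw [symmDiff_symmDiff_cancel_left, toVec_symmDiff]
  ring

/-- **Positive semidefiniteness** of the Grigoriev–Schoenebeck pseudo-density: `E D q² ≥ 0` for
every `q` of degree `≤ d/2` (the Cholesky/Gram argument of the moment matrix, here imported from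
`pseudoMoment_quadratic_nonneg`). [cite: FlemingKothariPitassi2019, §5.1 (Lemma 5.6, condition 5 and its proof, pp. 150–151)] -/
theorem cubeExpect_gsDensity_mul_sq_nonneg (hexp : VecExpands g r c) (hc : 0 < c)
    (hd : (d : ℝ) ≤ c * r / 2) (hr : 0 ≤ r) (hb : ∀ i, b i * b i = 1)
    {q : (Fin n → Bool) → ℝ} (hq : HasDegreeLE (d / 2) q) :
    0 ≤ cubeExpect (fun x => gsDensity n g b r d x * q x ^ 2) := by
  classical
  rw [cubeExpect_gsDensity_mul_sq_eq]
  set s₀ : Finset (Finset (Fin n)) := univ.filter fun S => 2 * S.card ≤ d with hs₀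
  have hzero : ∀ S : Finset (Fin n), S ∉ s₀ → cubeFourierCoeff q S = 0 := by
    intro S hS
    have hS' : ¬ 2 * S.card ≤ d := by simpa [hs₀] using hS
    refine hq.cubeFourierCoeff_eq_zero ?_
    by_contra hle
    push Not at hle
    exact hS' (by omega)
  -- restrict both sums to `s₀`
  have h1 : ∑ S : Finset (Fin n), ∑ T : Finset (Fin n),
        cubeFourierCoeff q S * cubeFourierCoeff q T * pseudoMoment g b r d (toVec S + toVec T) =
      ∑ S ∈ s₀, ∑ T ∈ s₀,
        cubeFourierCoeff q S * cubeFourierCoeff q T * pseudoMoment g b r d (toVec S + toVec T) := by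
    rw [← Finset.sum_subset (Finset.subset_univ s₀)]
    · refine Finset.sum_congr rfl fun S _ => ?_
      rw [← Finset.sum_subset (Finset.subset_univ s₀)]
      intro T _ hT
      rw [hzero T hT]; ring
    · intro S _ hS
      exact Finset.sum_eq_zero fun T _ => by rw [hzero S hS]; ring
  rw [h1]
  -- transport along `toVec`
  set a : ParityVec → ℝ := fun P => cubeFourierCoeff q (ofVec (n := n) P) with ha
  have hinj : Set.InjOn (toVec (n := n)) ↑s₀ := (toVec_injective (n := n)).injOn
  have h2 : ∑ S ∈ s₀, ∑ T ∈ s₀,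
        cubeFourierCoeff q S * cubeFourierCoeff q T * pseudoMoment g b r d (toVec S + toVec T) =
      ∑ P ∈ s₀.image toVec, ∑ P' ∈ s₀.image toVec, a P * a P' * pseudoMoment g b r d (P + P') := by
    rw [Finset.sum_image hinj]
    refine Finset.sum_congr rfl fun S _ => ?_
    rw [Finset.sum_image hinj]
    refine Finset.sum_congr rfl fun T _ => ?_
    simp only [ha, ofVec_toVec]
  rw [h2]
  refine pseudoMoment_quadratic_nonneg hexp hc hd hr hb _ a ?_
  intro P hP
  obtain ⟨S, hS, rfl⟩ := Finset.mem_image.1 hP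
  rw [card_support_toVec]
  simpa [hs₀] using hS

/-- **The Grigoriev–Schoenebeck pseudo-density is a degree-`d` pseudo-density** (normalised and
positive semidefinite on squares of degree `≤ d/2`), whenever the constraint family is
`(r, c)`-vector expanding, `b = ±1` and `d ≤ c r / 2`.
[cite: FlemingKothariPitassi2019, §5.1 (Lemma 5.6)] -/
theorem isPseudoDensity_gsDensity (hexp : VecExpands g r c) (hc : 0 < c)
    (hd : (d : ℝ) ≤ c * r / 2) (hr : 0 ≤ r) (hb : ∀ i, b i * b i = 1) :
    IsPseudoDensity d (gsDensity n g b r d) :=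
  ⟨cubeExpect_gsDensity hexp hc hd hr, fun _ hq => cubeExpect_gsDensity_mul_sq_nonneg hexp hc hd hr hb hq⟩

/-! #### Parity constraints of the family are satisfied exactly -/

/-- The indicator of the parity constraint `χ_S(x) = β` (`β = ±1`), as `(1 + β χ_S(x))/2`.
[cite: FlemingKothariPitassi2019, §5.1 (monomial equations `x_S = b`, p. 148)] -/
def xorSatInd (S : Finset (Fin n)) (β : ℝ) (x : Fin n → Bool) : ℝ := (1 + β * walsh S x) / 2

/-- `xorSatInd S β x = 1` if `χ_S(x) = β` and `= 0` otherwise (`β = ±1`).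
[cite: FlemingKothariPitassi2019, §5.1 (p. 148: monomial equations `x_S = b`, `b = ±1`)] -/
theorem xorSatInd_eq_ite (S : Finset (Fin n)) {β : ℝ} (hβ : β = 1 ∨ β = -1) (x : Fin n → Bool) :
    xorSatInd S β x = if walsh S x = β then 1 else 0 := by
  unfold xorSatInd
  have hw : walsh S x = 1 ∨ walsh S x = -1 := mul_self_eq_one_iff.1 (walsh_mul_self S x)
  rcases hβ with rfl | rfl <;> rcases hw with h | h <;> simp [h] <;> norm_num

/-- **A constraint of the family has pseudo-expectation one:** if `g i = toVec S` with `|S| ≤ d`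
then `E_x D(x) · [χ_S(x) = b i] = 1` (`Ẽ[y_{g i}] = b i`).
[cite: FlemingKothariPitassi2019, §5.1 (Lemma 5.6, condition 4, p. 150)] -/
theorem cubeExpect_gsDensity_mul_xorSatInd (hexp : VecExpands g r c) (hc : 0 < c)
    (hd : (d : ℝ) ≤ c * r / 2) (hr : 2 ≤ r) (hb : ∀ i, b i * b i = 1) (i : ι)
    (S : Finset (Fin n)) (hgi : g i = toVec S) (hS : S.card ≤ d) :
    cubeExpect (fun x => gsDensity n g b r d x * xorSatInd S (b i) x) = 1 := by
  have hr0 : (0 : ℝ) ≤ r := by linarith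
  have h1 : (fun x => gsDensity n g b r d x * xorSatInd S (b i) x) =
      fun x => gsDensity n g b r d x * ((1 / 2 : ℝ) * 1 + (b i / 2) * walsh S x) := by
    funext x; unfold xorSatInd; ring
  rw [h1, cubeExpect_mul_add, cubeExpect_mul_const_mul, cubeExpect_mul_const_mul,
    cubeExpect_mul_const, cubeExpect_gsDensity hexp hc hd hr0, cubeExpect_gsDensity_mul_walsh]
  have h2 := pseudoMoment_index_add hexp hc hd hr hb i (derivable_zero hr0) (T := 0)
    (by rw [add_zero, hgi, card_support_toVec]; exact hS)
  rw [add_zero, pseudoMoment_zero hexp hc hd hr0, mul_one] at h2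
  rw [← hgi, h2.2]
  have := hb i
  linear_combination (1 / 2 : ℝ) * this

/-! #### Clauses of the family pair to zero -/

/-- Extension of a point of `{0,1}ⁿ` to an assignment of all variables `ℕ` (by `false`).
[folklore] -/
def extAssign (x : Fin n → Bool) : ℕ → Bool := fun v => if h : v < n then x ⟨v, h⟩ else false

/-- `extAssign x v = x v` for `v < n`. [cite: FlemingKothariPitassi2019, §5.1 (p. 147: variables `x_1,…,x_n`)] -/
theorem extAssign_of_lt (x : Fin n → Bool) {v : ℕ} (hv : v < n) : extAssign x v = x ⟨v, hv⟩ := by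
  simp [extAssign, hv]

/-- The indicator that a clause is FALSE at a point of the cube (all literals false; tree
convention: the literal `(v, β)` is true iff `x_v = β`). [cite: FlemingKothariPitassi2019, §5.1 (p. 154: 3SAT from 3XOR)] -/
def unsatInd (C : Clause ℕ) (x : Fin n → Bool) : ℝ :=
  if Literature.Computability.Complexity.Clause.eval (extAssign x) C then 0 else 1

/-- `unsatInd` unfolded against `Clause.eval`. [cite: FlemingKothariPitassi2019, §5.1 (p. 154)] -/
theorem unsatInd_eq (C : Clause ℕ) (x : Fin n → Bool) :
    unsatInd C x = if Literature.Computability.Complexity.Clause.eval (extAssign x) C then 0 else 1 :=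
  rfl

/-- The falsity of one literal in `±1` coordinates: `[x_v ≠ β] = (1 + s_{(v,β)} · (−1)^{x_v})/2`
with `s = litSign`. [cite: FlemingKothariPitassi2019, §5.1 (p. 148: the basis change `1 − 2x`)] -/
theorem litFalse_eq (l : Literal ℕ) (hl : l.1 < n) (x : Fin n → Bool) :
    (if Literature.Computability.Complexity.Literal.eval (extAssign x) l then (0 : ℝ) else 1) =
      (1 + litSign l * sgn (x ⟨l.1, hl⟩)) / 2 := by
  rcases l with ⟨v, β⟩
  have h1 : Literature.Computability.Complexity.Literal.eval (extAssign x) (v, β) =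
      (x ⟨v, hl⟩ == β) := by
    simp [Literature.Computability.Complexity.Literal.eval, extAssign_of_lt x hl]
  rw [h1]
  simp only [litSign]
  cases β <;> cases x ⟨v, hl⟩ <;> simp [sgn]

/-- `unsatInd` is the product of the literal falsities. [cite: FlemingKothariPitassi2019, §5.1 (p. 154, "φ_⊕")] -/
theorem unsatInd_eq_prod (C : Clause ℕ) (x : Fin n → Bool) :
    unsatInd C x = (C.map fun l =>
      if Literature.Computability.Complexity.Literal.eval (extAssign x) l then (0 : ℝ) else 1).prod := by
  induction C with
  | nil => simp [unsatInd_eq, Literature.Computability.Complexity.Clause.eval]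
  | cons l C ih =>
    rw [List.map_cons, List.prod_cons, ← ih, unsatInd_eq, unsatInd_eq]
    have hcons : Literature.Computability.Complexity.Clause.eval (extAssign x) (l :: C) =
        (Literature.Computability.Complexity.Literal.eval (extAssign x) l ||
          Literature.Computability.Complexity.Clause.eval (extAssign x) C) := by
      simp [Literature.Computability.Complexity.Clause.eval, List.any_cons]
    rw [hcons]
    cases Literature.Computability.Complexity.Literal.eval (extAssign x) l <;>
      cases Literature.Computability.Complexity.Clause.eval (extAssign x) C <;> simp

/-- The variable of the `j`-th literal of a clause whose variables are `< n`, as an element of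
`Fin n`. [folklore] -/
def litVar (C : Clause ℕ) (hC : ∀ l ∈ C, l.1 < n) (j : Fin C.length) : Fin n :=
  ⟨(C[j]).1, hC _ (List.getElem_mem j.2)⟩

/-- For a clause on distinct variables, `litVar` is injective. [cite: FlemingKothariPitassi2019, §5.1 (Def. 5.1: `i, j, k` distinct, p. 147)] -/
theorem litVar_injective (C : Clause ℕ) (hC : ∀ l ∈ C, l.1 < n) (hnd : (C.map Prod.fst).Nodup) :
    Function.Injective (litVar C hC) := by
  intro j₁ j₂ h
  have h' : (C[j₁]).1 = (C[j₂]).1 := by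
    have := congrArg Fin.val h
    simpa [litVar] using this
  have e1 : (C.map Prod.fst)[j₁.1]'(by simp) = (C[j₁]).1 := List.getElem_map ..
  have e2 : (C.map Prod.fst)[j₂.1]'(by simp) = (C[j₂]).1 := List.getElem_map ..
  exact Fin.ext ((hnd.getElem_inj_iff).1 (e1.trans (h'.trans e2.symm)))

/-- The set of variables of a set of literal positions goes to `litVec`. [cite: FlemingKothariPitassi2019, §5.1 (p. 154)] -/
theorem toVec_image_litVar (C : Clause ℕ) (hC : ∀ l ∈ C, l.1 < n) (hnd : (C.map Prod.fst).Nodup)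
    (J : Finset (Fin C.length)) : toVec (J.image (litVar C hC)) = litVec C J := by
  classical
  rw [toVec, litVec, Literature.Computability.MetaComplexity.indVec_eq_sum, Finset.map_eq_image,
    Finset.image_image, Finset.sum_image]
  · rfl
  · intro j₁ _ j₂ _ h
    exact litVar_injective C hC hnd (Fin.ext (by simpa [litVar] using h))

/-- **Walsh expansion of clause falsity:**
`[C false at x] = 2^{-|C|} Σ_{J ⊆ positions} σ_J · χ_{vars J}(x)`.
[cite: FlemingKothariPitassi2019, §5.1 (p. 154, "define φ_⊕ …"; Schoenebeck 2008 §5)] -/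
theorem unsatInd_eq_sum (C : Clause ℕ) (hC : ∀ l ∈ C, l.1 < n) (hnd : (C.map Prod.fst).Nodup)
    (x : Fin n → Bool) :
    unsatInd C x = (1 / 2) ^ C.length *
      ∑ J ∈ (univ : Finset (Fin C.length)).powerset,
        posSign C J * walsh (J.image (litVar C hC)) x := by
  classical
  rw [unsatInd_eq_prod]
  -- the list product as a product over positions
  have h1 : (C.map fun l =>
      if Literature.Computability.Complexity.Literal.eval (extAssign x) l then (0 : ℝ) else 1) =
      List.ofFn fun j : Fin C.length =>
        (1 + litSign C[j] * sgn (x (litVar C hC j))) / 2 := by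
    apply List.ext_getElem
    · simp
    · intro j hj₁ hj₂
      rw [List.getElem_map, List.getElem_ofFn]
      exact litFalse_eq _ (hC _ (List.getElem_mem _)) _
  rw [h1, List.prod_ofFn]
  have h2 : ∏ j : Fin C.length, (1 + litSign C[j] * sgn (x (litVar C hC j))) / 2 =
      (1 / 2) ^ C.length * ∏ j : Fin C.length, (litSign C[j] * sgn (x (litVar C hC j)) + 1) := by
    rw [Finset.prod_div_distrib, Finset.prod_const, Finset.card_univ, Fintype.card_fin]
    rw [div_eq_mul_inv, mul_comm, ← inv_pow, inv_eq_one_div]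
    congr 1
    exact Finset.prod_congr rfl fun j _ => by ring
  rw [h2, Finset.prod_add]
  congr 1
  refine Finset.sum_congr rfl fun J _ => ?_
  rw [Finset.prod_const_one, mul_one, Finset.prod_mul_distrib, posSign]
  congr 1
  rw [walsh, Finset.prod_image]
  intro j₁ _ j₂ _ h
  exact litVar_injective C hC hnd h

/-- **A clause of the family pairs to zero:** if the clause `C` (distinct variables `< n`,
`1 ≤ |C| ≤ d`) sits at index `i` of the family (`g i = clauseVec C`, `b i = clauseSign C`), then
`E_x D(x) · [C false at x] = 0`. [cite: FlemingKothariPitassi2019, §5.1 (p. 154: soundness of the 3XOR pseudo-expectation for the 3SAT instance; Schoenebeck 2008 Thm 5.1)] -/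
theorem cubeExpect_gsDensity_mul_unsatInd (hexp : VecExpands g r c) (hc : 0 < c)
    (hd : (d : ℝ) ≤ c * r / 2) (hr : 2 ≤ r) (hb : ∀ i, b i * b i = 1) (C : Clause ℕ)
    (hC : ∀ l ∈ C, l.1 < n) (hnd : (C.map Prod.fst).Nodup) (hlen : 0 < C.length)
    (hCd : C.length ≤ d) (i : ι) (hgi : g i = clauseVec C) (hbi : b i = clauseSign C) :
    cubeExpect (fun x => gsDensity n g b r d x * unsatInd C x) = 0 := by
  classical
  simp_rw [unsatInd_eq_sum C hC hnd]
  rw [cubeExpect_mul_const_mul, cubeExpect_mul_finset_sum]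
  have h1 : ∀ J ∈ (univ : Finset (Fin C.length)).powerset,
      cubeExpect (fun x => gsDensity n g b r d x * (posSign C J * walsh (J.image (litVar C hC)) x)) =
        posSign C J * pseudoMoment g b r d (litVec C J + 0) := by
    intro J _
    rw [cubeExpect_mul_const_mul, cubeExpect_gsDensity_mul_walsh, toVec_image_litVar C hC hnd,
      add_zero]
  rw [Finset.sum_congr rfl h1,
    sum_posSign_pseudoMoment_eq_zero hexp hc hd hr hb C hlen i hgi hbi 0 (by simpa using hCd),
    mul_zero]

end Density

end Literature.Combinatorics.Optimization
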